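import Summits.Ventures.CertifiedManyBodySolver.Rows.CorrWindowCertKernelChainQuotAdjNearCloser
import HarnessLib

/-!
# EOM LOCALITY WITHOUT MASK DATA: the near/far split of the window Hamiltonian COMPUTED IN THE KERNEL (`autoMasks`), its far check a
# THEOREM (`eomFarOK_autoMasks`), and the per-generator introduction lemma for explicit masks (`eomFarOK_of_forall`)

HONEST FRAMING: Lean plumbing towards «tier P» (successor item of HOME/HANDOFF «obs-p2 v23.0»; captain SUCCESSOR LIST 2026-08-29T00:12:59Z
(1) «the per-generator `eomFarOK` introduction lemma»). The closer of record `affineOrbitLowerRowN_of_quotAdjChainKernelCert{G,TB}Near`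
(`Rows/CorrWindowCertKernelChainQuotAdjNearCloser.lean`) takes per-generator MASKS selecting the near terms of the window Hamiltonian `TH`
and the decidable far check `hfar : eomFarOK TH f EB masks = true`; at the Rm2 geometry (`hamTermsBox 13`, 11 753 terms, 44 generators)
the masks are ≈ 5·10⁵ Booleans of exporter data and `hfar` is one large `decide`. Here (§1) `autoMask TH B` = the MINIMAL sound near set
(a term is near iff it has odd length or shares a letter index with a word of `B`), computed by the kernel from `TH` and `B` alone, and
`farOK_splitMask_autoMask : farOK (splitMask TH (autoMask TH B)).2 B = true` for EVERY `TH`, `B` (structural induction, no data);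
(§2) `autoMasks TH f EB` (one auto mask per generator, in `eomNearSlices` order) and **`eomFarOK_autoMasks : eomFarOK TH f EB (autoMasks TH f
EB) = true`** — so an instance passes `masks := autoMasks TH D.f EB`, `hfar := eomFarOK_autoMasks TH D.f EB` to the closer of record
UNCHANGED: no mask data, no far-check declaration; the disjointness tests run inside each eom step's own kernel fact (one generator per
step); the accumulators are unchanged (far products cancel in the normal form; any mask passing `eomFarOK` selects a superset of the auto
near set); (§3) for instances that keep explicit masks, `eomFarOK_of_forall` assembles `eomFarOK` from one `farOK` fact per generator
(each its own `decide`, `Fin` match); (§4) the auto-mask editions of the two closers of record, `…GAuto` / `…TBAuto` (two arguments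
fewer, nothing else). No certificate, no number of record; nothing discharged; CONTROL/CALIBRATION context (wording (xx1)); silent on the
presence of superconductivity; not a `T_c` or phase sentence; nothing about any material; no summit statement is proved by this file.
Seat hubbard-obs-p2 (STIFFNESS), `prover-hubbard-obs-p2-g24-0`, zero compute.

References: O. Bratteli, D. W. Robinson, *Operator Algebras and Quantum Statistical Mechanics 2* §5.2.2 (graded commutation of even
elements with disjointly supported ones) [BratteliRobinsonII1997]; X. Han, arXiv:2006.06002 §3 (the eom family `ω([H, O]) = 0` with local
`H`) [Han2020Bootstrap]; J. Wang et al., PRX 14 (2024) 031006 §III [WangEtAl2024]; C. Jansson, D. Chaykin, C. Keil, SIAM J. Numer. Anal. 46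
(2008) 180 [JanssonChaykinKeil2008].
-/

namespace Summit.Ventures.CertifiedManyBodySolver

namespace CARPolyWindow

open Summit.Ventures.CertifiedQuantumChemistry Summit.Ventures.CertifiedQuantumChemistry.CARPoly
open Literature.MathematicalPhysics.QuantumLattice Literature.MathematicalPhysics.QuantumLattice.HubbardWave0
open Literature.MathematicalPhysics.QuantumManyBody.StateRelaxation
open Literature.Probability.LatticeModels ThermodynamicLimit Filter Topology
open Matrix
open scoped ComplexOrder BigOperators

/-! ## §1 The auto mask of one generator -/

section AutoMask

variable {α β : Type*} [DecidableEq α]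

/-- **The near test of a Hamiltonian term against a generator**: odd length, or a letter index shared with some word of `B` (the
negation of the far predicate of `farOK`). [cite: BratteliRobinsonII1997, §5.2.2] -/
def nearT (B : Terms α) (t : List (α × Bool) × ℚ) : Bool :=
  !(decide (t.1.length % 2 = 0) && B.all fun b => disjW t.1 b.1)

/-- **The auto mask** of `TH` for the generator `B`: `true` = near, in `TH` order (the minimal sound near set). [folklore] -/
def autoMask (TH B : Terms α) : List Bool := TH.map (nearT B)

/-- `autoMask` of a cons. [folklore] -/
theorem autoMask_cons (t : List (α × Bool) × ℚ) (TH B : Terms α) : autoMask (t :: TH) B = nearT B t :: autoMask TH B := rfl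

/-- **The far part selected by the auto mask passes the far check — for every `TH` and `B`, no data.**
[cite: BratteliRobinsonII1997, §5.2.2] -/
theorem farOK_splitMask_autoMask (B : Terms α) : ∀ TH : Terms α, farOK (splitMask TH (autoMask TH B)).2 B = true
  | [] => by simp [splitMask, farOK]
  | t :: TH => by
    have ih := farOK_splitMask_autoMask B TH
    rw [autoMask_cons]
    cases h : nearT B t with
    | true =>
      rw [splitMask]
      exact ih
    | false =>
      have hP : (decide (t.1.length % 2 = 0) && B.all fun b => disjW t.1 b.1) = true := by
        simpa [nearT] using h
      rw [splitMask]
      show farOK (t :: (splitMask TH (autoMask TH B)).2) B = true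
      rw [farOK, List.all_cons, ← farOK, hP, ih, Bool.true_and]

/-- The near part selected by the auto mask: every term kept is near (odd or letter-sharing). [folklore] -/
theorem splitMask_autoMask_fst_near (B : Terms α) : ∀ TH : Terms α, ∀ t ∈ (splitMask TH (autoMask TH B)).1, nearT B t = true
  | [] => by simp [splitMask]
  | t :: TH => by
    intro u hu
    rw [autoMask_cons] at hu
    cases h : nearT B t with
    | true =>
      rw [h, splitMask] at hu
      rcases List.mem_cons.1 hu with rfl | hu
      · exact h
      · exact splitMask_autoMask_fst_near B TH u hu
    | false =>
      rw [h, splitMask] at hu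
      exact splitMask_autoMask_fst_near B TH u hu

end AutoMask

/-! ## §2 The auto masks of all generators and the far check as a theorem -/

section AutoMasks

variable {α β : Type*} [DecidableEq α]

/-- Reading the `k`-th entry of a `finL`-indexed table. [folklore] -/
theorem getD_map_finL {γ : Type*} : ∀ (n : ℕ) (g : Fin n → γ) (dflt : γ) (k : Fin n), ((finL n).map g).getD k.val dflt = g k
  | 0, _, _, k => k.elim0
  | n + 1, g, dflt, k => by
    refine Fin.cases ?_ (fun j => ?_) k
    · rw [finL, List.map_cons, Fin.val_zero, List.getD_cons_zero]
    · rw [finL, List.map_cons, Fin.val_succ, List.getD_cons_succ, List.map_map, getD_map_finL n (g ∘ Fin.succ) dflt j]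
      rfl

/-- **The auto masks**: one auto mask per generator `B_k` (pushed by `f`), in `eomNearSlices` order. [folklore] -/
def autoMasks (TH : Terms α) (f : β → α) (EB : List (Terms β)) : List (List Bool) :=
  (finL EB.length).map fun k => autoMask TH (wmapT f (EB.get k))

/-- Reading the `k`-th auto mask. [folklore] -/
theorem autoMasks_getD (TH : Terms α) (f : β → α) (EB : List (Terms β)) (k : Fin EB.length) :
    (autoMasks TH f EB).getD k.val [] = autoMask TH (wmapT f (EB.get k)) :=
  getD_map_finL EB.length (fun k => autoMask TH (wmapT f (EB.get k))) [] k

/-- **THE FAR CHECK IS A THEOREM for the auto masks: `eomFarOK TH f EB (autoMasks TH f EB) = true` — every `TH`, `f`, `EB`.**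
[cite: BratteliRobinsonII1997, §5.2.2] [cite: Han2020Bootstrap, §3] -/
theorem eomFarOK_autoMasks (TH : Terms α) (f : β → α) (EB : List (Terms β)) : eomFarOK TH f EB (autoMasks TH f EB) = true := by
  rw [eomFarOK, List.all_eq_true]
  intro k _
  rw [autoMasks_getD]
  exact farOK_splitMask_autoMask _ _

/-- **The near eom slices with auto masks denote the FULL eom family** — no far-check hypothesis. [cite: Han2020Bootstrap, §3]
[cite: BratteliRobinsonII1997, §5.2.2] -/
theorem termOp_flatten_eomNearSlices_auto {ι : Type*} [LinearOrder ι] [Fintype ι] {d : α → ι} (hd : Function.Injective d)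
    (TH : Terms α) (f : β → α) (EB : List (Terms β)) :
    termOp d (eomNearSlices TH f EB (autoMasks TH f EB)).flatten = termOp d (negT (eomTβ TH f EB)) :=
  termOp_flatten_eomNearSlices hd TH f EB (autoMasks TH f EB) (eomFarOK_autoMasks TH f EB)

/-- **The eom-near residual slices with auto masks denote the residual** — no far-check hypothesis. [cite: WangEtAl2024, §III]
[cite: Han2020Bootstrap, §3] -/
theorem termOp_flatten_residTGslicesNear_auto {ι : Type*} [LinearOrder ι] [Fintype ι] {d : α → ι} (hd : Function.Injective d)
    (TX : Terms α) (μ : Fin 2 → ℚ) (ν : ℚ) (o : Fin 2 → α) (κhi hi κlo lo : ℚ) (TE : Terms α)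
    (TGs : List (Terms α)) (TH : Terms α) (f : β → α) (EB : List (Terms β))
    {nS : ℕ} (g : Fin nS → β → α) (SY : Fin nS → Terms β) (CW : Terms α) (AV : List (Terms α)) :
    termOp d (residTGslicesNear TX μ ν o κhi hi κlo lo TE TGs TH f EB (autoMasks TH f EB) g SY CW AV).flatten =
      termOp d (residTG TX μ ν o κhi hi κlo lo TE TGs.flatten TH f EB g SY CW AV) :=
  termOp_flatten_residTGslicesNear hd TX μ ν o κhi hi κlo lo TE TGs TH f EB (autoMasks TH f EB) g SY CW AV (eomFarOK_autoMasks TH f EB)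

end AutoMasks

/-! ## §3 Explicit masks: the far check assembled per generator -/

section PerGenerator

variable {α β : Type*} [DecidableEq α]

/-- **Per-generator introduction of the far check**: one `farOK` fact per generator (each its own `decide`, assembled by `Fin` match)
gives `eomFarOK`. [folklore] -/
theorem eomFarOK_of_forall (TH : Terms α) (f : β → α) (EB : List (Terms β)) (masks : List (List Bool))
    (h : ∀ k : Fin EB.length, farOK (splitMask TH (masks.getD k.val [])).2 (wmapT f (EB.get k)) = true) :
    eomFarOK TH f EB masks = true := by
  rw [eomFarOK, List.all_eq_true]
  exact fun k _ => h k

/-- The converse reading: `eomFarOK` gives the far check of each generator. [folklore] -/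
theorem farOK_of_eomFarOK (TH : Terms α) (f : β → α) (EB : List (Terms β)) (masks : List (List Bool))
    (h : eomFarOK TH f EB masks = true) (k : Fin EB.length) :
    farOK (splitMask TH (masks.getD k.val [])).2 (wmapT f (EB.get k)) = true :=
  all_finL (P := fun k => farOK (splitMask TH (masks.getD k.val [])).2 (wmapT f (EB.get k))) h k

end PerGenerator

/-! ## §4 The closers of record, auto-mask editions -/

noncomputable section AutoCloser

variable {N Nβ : ℕ} [NeZero N]

/-- **CLOSER OF RECORD, ABSTRACT GRAM SLICES, AUTO MASKS**: as `affineOrbitLowerRowN_of_quotAdjChainKernelCertGNear` with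
`masks := autoMasks TH D.f EB` and NO far-check hypothesis. [cite: WangEtAl2024, §III] [cite: Han2020Bootstrap, §3]
[cite: JanssonChaykinKeil2008, §3] [cite: BratteliRobinsonII1997, §5.2.2] -/
theorem affineOrbitLowerRowN_of_quotAdjChainKernelCertGAuto
    (tp U : ℚ) (hU : 0 ≤ U)
    {Λ Λ' : Finset (Site 2)} (hΛ : Λ ⊆ Λ') (h8 : thicken Λ 1 ⊆ Λ')
    (h0 : thicken ({0} : Finset (Site 2)) 1 ⊆ Λ') (hz : (0 : Site 2) ∈ Λ')
    {S : Finset (DihedralGroup 4)} (h1 : (1 : DihedralGroup 4) ∈ S) (hmul : ∀ a ∈ S, ∀ b ∈ S, a * b ∈ S)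
    (D : QuotData N Nβ) (hxs : ∀ i, D.xs i ∈ Λ') (hix : ∀ y ∈ Λ', D.xs (D.ix y) = y)
    (hxsβ : ∀ j, D.xsβ j ∈ Λ) (hcovβ : ∀ x ∈ Λ, ∃ j, D.xsβ j = x)
    (d : Orb (Fin N) → Orb (PolySite Λ')) (hd : Function.Injective d)
    (hdx : ∀ i σ, d (orb i σ) = orb (PolySite.pt (D.xs i) (hxs i)) σ) (Bkey : ℕ)
    (dΛ : Orb (Fin Nβ) → Orb (PolySite Λ)) (hdΛ : ∀ j σ, dΛ (orb j σ) = orb (PolySite.pt (D.xsβ j) (hxsβ j)) σ)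
    (hf : ∀ b, d (D.f b) = Orb.embMap (PolySite.incl hΛ) (dΛ b))
    (sp : Orb (Fin N) → Fin 2) (hsp : ∀ a, (ofLex (d a)).2 = sp a)
    (hokS : ∀ γc v, D.ok γc v = true → d4OfCode γc ∈ S)
    (hokV : ∀ γc v, D.ok γc v = true →
      ∀ j : Fin Nβ, D.xs (D.ix (d4Vec (d4OfCode γc) (D.xsβ j) + siteOfPair v)) = d4Vec (d4OfCode γc) (D.xsβ j) + siteOfPair v)
    (TH : Terms (Orb (Fin N))) (hH : termOp d TH = (hubbardTTPrimeFermionInteraction 1 tp U).localHamiltonian Λ')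
    (TE : Terms (Orb (Fin N)))
    (hE : termOp d TE = fermionEmbed (PolySite.incl h0) ((hubbardTTPrimeFermionInteraction 1 tp U).meanEnergyObs 1))
    (o : Fin 2 → Orb (Fin N)) (ho : ∀ σ, d (o σ) = orb (PolySite.pt 0 hz) σ)
    (TX : Terms (Orb (Fin N))) (μ : Fin 2 → ℚ) (ν κhi hi κlo lo : ℚ)
    (TGs : List (Terms (Orb (Fin N)))) {m : Type*} [Fintype m] [DecidableEq m] {Λm : Matrix m m ℂ} (hΛm : Λm.PosSemidef)
    (O : m → FermionOp Λ') (hTG : termOp d TGs.flatten = gramForm Λm O) (EB : List (Terms (Orb (Fin Nβ))))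
    (CW : Terms (Orb (Fin N))) (hcw : ∀ wc ∈ CW, chargeW wc.1 ≠ 0 ∨ spinChargeW sp wc.1 ≠ 0)
    (AV : List (Terms (Orb (Fin N))))
    (ns : List ℕ) (M : ℕ) (Cs : List SOSDual.EncPoly) (hC0 : Cs.getD 0 [] = []) (Hs : List (List (QHint Nβ)))
    (hchain : ChainQAOK D Bkey M Cs
      (groupSlices (residTGslicesNear TX μ ν o κhi hi κlo lo TE TGs TH D.f EB (autoMasks TH D.f EB)
        (fun l : Fin 0 => l.elim0) (fun l : Fin 0 => l.elim0) CW AV) ns) Hs)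
    {q s n₀ : ℚ} (hs : s = (μ 0 + μ 1) / 2)
    (hq : q ≤ lowerConst (SOSDual.decPoly N (Cs.getD M [])) + (μ 0 + μ 1) * (n₀ / 2 - ν)) :
    SquareTTPrimeCorrAffineOrbitLowerRowN (tp : ℝ) (U : ℝ) q hi lo κhi κlo s n₀ S Λ' (termOp d TX) :=
  affineOrbitLowerRowN_of_quotAdjChainKernelCertGNear tp U hU hΛ h8 h0 hz h1 hmul D hxs hix hxsβ hcovβ d hd hdx Bkey dΛ hdΛ hf sp hsp
    hokS hokV TH hH TE hE o ho TX μ ν κhi hi κlo lo TGs hΛm O hTG EB (autoMasks TH D.f EB) (eomFarOK_autoMasks TH D.f EB) CW hcw AV ns M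
    Cs hC0 Hs hchain hs hq

/-- **CLOSER OF RECORD, TWO-LEVEL GRAM, AUTO MASKS**: as `affineOrbitLowerRowN_of_quotAdjChainKernelCertTBNear` with
`masks := autoMasks TH D.f EB` and NO far-check hypothesis. [cite: WangEtAl2024, §III] [cite: Han2020Bootstrap, §3]
[cite: JanssonChaykinKeil2008, §3] -/
theorem affineOrbitLowerRowN_of_quotAdjChainKernelCertTBAuto
    (tp U : ℚ) (hU : 0 ≤ U)
    {Λ Λ' : Finset (Site 2)} (hΛ : Λ ⊆ Λ') (h8 : thicken Λ 1 ⊆ Λ')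
    (h0 : thicken ({0} : Finset (Site 2)) 1 ⊆ Λ') (hz : (0 : Site 2) ∈ Λ')
    {S : Finset (DihedralGroup 4)} (h1 : (1 : DihedralGroup 4) ∈ S) (hmul : ∀ a ∈ S, ∀ b ∈ S, a * b ∈ S)
    (D : QuotData N Nβ) (hxs : ∀ i, D.xs i ∈ Λ') (hix : ∀ y ∈ Λ', D.xs (D.ix y) = y)
    (hxsβ : ∀ j, D.xsβ j ∈ Λ) (hcovβ : ∀ x ∈ Λ, ∃ j, D.xsβ j = x)
    (d : Orb (Fin N) → Orb (PolySite Λ')) (hd : Function.Injective d)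
    (hdx : ∀ i σ, d (orb i σ) = orb (PolySite.pt (D.xs i) (hxs i)) σ) (Bkey : ℕ)
    (dΛ : Orb (Fin Nβ) → Orb (PolySite Λ)) (hdΛ : ∀ j σ, dΛ (orb j σ) = orb (PolySite.pt (D.xsβ j) (hxsβ j)) σ)
    (hf : ∀ b, d (D.f b) = Orb.embMap (PolySite.incl hΛ) (dΛ b))
    (sp : Orb (Fin N) → Fin 2) (hsp : ∀ a, (ofLex (d a)).2 = sp a)
    (hokS : ∀ γc v, D.ok γc v = true → d4OfCode γc ∈ S)
    (hokV : ∀ γc v, D.ok γc v = true →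
      ∀ j : Fin Nβ, D.xs (D.ix (d4Vec (d4OfCode γc) (D.xsβ j) + siteOfPair v)) = d4Vec (d4OfCode γc) (D.xsβ j) + siteOfPair v)
    (TH : Terms (Orb (Fin N))) (hH : termOp d TH = (hubbardTTPrimeFermionInteraction 1 tp U).localHamiltonian Λ')
    (TE : Terms (Orb (Fin N)))
    (hE : termOp d TE = fermionEmbed (PolySite.incl h0) ((hubbardTTPrimeFermionInteraction 1 tp U).meanEnergyObs 1))
    (o : Fin 2 → Orb (Fin N)) (ho : ∀ σ, d (o σ) = orb (PolySite.pt 0 hz) σ)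
    (TX : Terms (Orb (Fin N))) (μ : Fin 2 → ℚ) (ν κhi hi κlo lo : ℚ) (K : ℕ)
    (blocks : List (List (List ℤ × Terms (Orb (Fin N))))) (EB : List (Terms (Orb (Fin Nβ))))
    (CW : Terms (Orb (Fin N))) (hcw : ∀ wc ∈ CW, chargeW wc.1 ≠ 0 ∨ spinChargeW sp wc.1 ≠ 0)
    (AV : List (Terms (Orb (Fin N))))
    (ns : List ℕ) (M : ℕ) (Cs : List SOSDual.EncPoly) (hC0 : Cs.getD 0 [] = []) (Hs : List (List (QHint Nβ)))
    (hchain : ChainQAOK D Bkey M Cs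
      (groupSlices (residTGslicesNear TX μ ν o κhi hi κlo lo TE (gramTBslices K blocks) TH D.f EB (autoMasks TH D.f EB)
        (fun l : Fin 0 => l.elim0) (fun l : Fin 0 => l.elim0) CW AV) ns) Hs)
    {q s n₀ : ℚ} (hs : s = (μ 0 + μ 1) / 2)
    (hq : q ≤ lowerConst (SOSDual.decPoly N (Cs.getD M [])) + (μ 0 + μ 1) * (n₀ / 2 - ν)) :
    SquareTTPrimeCorrAffineOrbitLowerRowN (tp : ℝ) (U : ℝ) q hi lo κhi κlo s n₀ S Λ' (termOp d TX) :=
  affineOrbitLowerRowN_of_quotAdjChainKernelCertTBNear tp U hU hΛ h8 h0 hz h1 hmul D hxs hix hxsβ hcovβ d hd hdx Bkey dΛ hdΛ hf sp hsp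
    hokS hokV TH hH TE hE o ho TX μ ν κhi hi κlo lo K blocks EB (autoMasks TH D.f EB) (eomFarOK_autoMasks TH D.f EB) CW hcw AV ns M Cs
    hC0 Hs hchain hs hq

end AutoCloser

end CARPolyWindow

end Summit.Ventures.CertifiedManyBodySolver
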